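import Summits.QuantumFields.YangMills.Theorems.BalabanUVNodesN22AtRecordOfPrintedSlots

/-!
# NODE N22 (NE9) — K3⁷ v5 §2b's raw inputs `h9` ∕ `hdec` and the N22 ∕ (D4) pin faces AT THE RECORD with W1's two (2.38)-slots READ FROM THE YOUNG-COUPLING MARGIN DATUM
# (J31) and the activity holomorphy READ FROM PRINT (`AnalyticH`, [II] p. 15) — companion of `…N22AtRecordOfPrintedSlots`

Cell `pub-ymgap`, Track A (HUMAN RULING D-0062), WIDTH SEAT `dag-n22-w5` (g0) on node n22 = NE9, D-0154 (3a) second width wave; `--kind proof --supports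
stmt-QuantumFields-20544 --as helper` (K3⁷ `SpineGivenEndpointR13SepCoPH`, skeleton v5 941dddb108cbaacf), COUNT-NEUTRAL; THEOREMS ONLY (0 `def`, 0 `sorry`, standard axioms).
Second half of the piece «(B)∘J32′ AT THE RECORD» (pub-ymgap INBOX l.29234 ∕ l.29362; CLAIM-1 l.29287): `…N22AtRecordOfPrintedSlots` (this seat) read at the prefix sets
`W1.box θ.γ k` with W1's two (2.38)-slots `Bound238` ∕ `YoungLipschitz` DISCHARGED per `(K, k)` from J31's young-coupling MARGIN DATUM (dag-n22-c, p605695: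
`bound238_box_of_coordHolo` ∕ `youngLipschitz_box_of_coordHolo` — J32′ §2's road, here at the record): for every prefix `hist ∈ box θ.γ k`, polymer `Z`, configuration
`φ ∈ sp K k Z` and young coupling `i`, a holomorphic extension of `t ↦ H(Z; hist|hist_i := t; φ)` to a set containing the closed `ρt (k+1) i`-discs about `]0, θ.γ]`, bounded by
`A·e^{−R d_{k+1}(Z)}`; Cauchy table `Λ (k+1) i = 4A∕ρt (k+1) i`.  Nothing of (A)∕(B)∕J31∕J32′ is re-declared; every step is plain application.

WHAT.  ★★★ `ne9_EA_objectsOfRecord₁₃_of_coordHolo_analyticH` (K3⁷ v5 §2b's `h9`) — and its VERTEX edition ★★★ `ne9_EA_objectsOfRecord₁₃_of_coordHoloVertex_analyticH` (§1b: J31b's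
relative-disc datum in the LAST coupling, J32′ §2b's g-independent table `if i + 1 < n then 4A∕ρt n i else 8A′∕min(c,1)`, amplitude `A′·θ.γ`) —, ★★★ `kernelDecayOfRecord₁₃_of_coordHolo_analyticH` (its `hdec`, any `κ′ ≤ δ₁`; only `Bound238` is used),
★★★ `n22At_rateCarriers_of_kernels_pin_of_coordHolo_analyticH` (the N22 pin face, every run length) and ★★★ `readOutAt_rateCarriers_of_kernels_pin_of_coordHolo_analyticH` (the (D4)
pin face via dag-n27-w1's `readOutAt_objectsOfRecord₁₃_coPH`).  DISPLAYED INPUTS after this file: the towers∕reading with W1-20's law `Localizes17OfRecord₁₃`; the margin datum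
(coupling holomorphy with uniform margins in EVERY young coupling — NOT PRINTED in this strength: print has [I] p. 263 «C^∞ (or analytic)» in the LAST coupling only; vertex-awareness
as in J31∕J31b: the table is read at `i = k` too, a relative-disc edition is J32′ §2b's); W1's PRINTED `AnalyticH` on the boxes; the holomorphic readings `Φ` with chart∕space
clauses; the site weights with the minimizer tails ([I] p. 282); Road 1's numerals; `PolLimitsExistOfRecord₁₃`; and the letter domination rows `ℓ.κ ≤ δ₁`,
`C_9·(4A∕ρt k i) ≤ ℓ.moduli k i` (dag-n22-w1 g2's `letterModuli_le_iff_radii`: radius growth in the age of the coupling).  A5∕A6: J31 `coordHolo_termlessStep`,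
`…N22AtRecordOfPrintedSlots.analyticH_termlessStep` and dag-n22-w2 g3's `…AtSlotsInhabited` inhabit the non-record hypotheses at the EMPTY towers (DEGENERATE, declared); the law,
`PolLimitsExistOfRecord₁₃`, `θ` and the reading OF RECORD are LOCATED hypotheses, NOT inhabited here.

HONEST FRAMING (binding).  Count-neutral COMPOSITION of landed theorems by name; NO estimate of Bałaban's is proved or asserted; every displayed input above is a
HYPOTHESIS with its owner; nothing of the record is constructed or claimed to meet them; N22 and (D4) are NOT discharged (typed 28∕28 · discharged 5∕27 UNCHANGED); K3⁷ OPEN and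
NOT claimed; NE9 is NOT IN PRINT for d = 4; no count claim (the chair's single count line is the only count); no summit statement is proved by this seat; one finite 𝕋⁴
programme at fixed ε — R4 closes the CONDITIONAL rung `BalabanLadder.UV` only; NOTHING about the continuum limit, ℝ⁴, infinite volume, OS axioms, a mass gap or the Clay
problem is proved or claimed by any of this.  References (TYPES only): [I] = Bałaban, CMP 109 (1987) §1 p. 263, (1.20)–(1.21) p. 264, p. 282, (5.10) p. 293; [II] = CMP 116
(1988) (2.13)–(2.14) pp. 14–15, p. 15, (2.38) p. 20, (2.39)–(2.41) p. 21.
-/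

noncomputable section

open Filter Topology Metric Set
open scoped BigOperators

namespace YMDAG.N22.AtRecordOfCouplingHoloSlots

open Literature.MathematicalPhysics.QuantumFieldTheory.Balaban1983to89
open Literature.MathematicalPhysics.QuantumFieldTheory.Balaban1983to89.T4Continuum (T4Family ULoop)
open Literature.MathematicalPhysics.QuantumFieldTheory.Balaban1983to89.T4OutputRate (Window NE9)
open Literature.MathematicalPhysics.QuantumFieldTheory.Balaban1983to89.Node00 (Stage13Params Stage13HParams U3Letters₁₁ MatA datumOfRecord₁₃CoPH)
open Literature.MathematicalPhysics.QuantumFieldTheory.Balaban1983to89.Node00.Sect2 (domCount domSys CPair)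
open Literature.MathematicalPhysics.QuantumFieldTheory.Balaban1983to89.Node00.LocalizedSum17 (ReadingMaps Localizes17OfRecord₁₃)
open Literature.MathematicalPhysics.QuantumFieldTheory.Balaban1983to89.Node00.W1 (ClusterTower ClusterStep box)
open Literature.MathematicalPhysics.QuantumFieldTheory.Balaban1983to89.Node00.U3OfKernels (histPrefix objectsOfRecord₁₃ KernelDecayOfRecord₁₃)
open Literature.MathematicalPhysics.QuantumFieldTheory.Balaban1983to89.Node00.U3KernelLetters (PolLimitsExistOfRecord₁₃)
open Literature.MathematicalPhysics.QuantumFieldTheory.Balaban1983to89.B12Decay510 (delta1)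
open Literature.MathematicalPhysics.QuantumFieldTheory.Balaban1983to89.B12Decay510Window (K₁)
open Literature.MathematicalPhysics.QuantumFieldTheory.Balaban1983to89.B12Decay510Torus (distCT nearT)
open Literature.MathematicalPhysics.QuantumFieldTheory.Balaban1983to89.B12TreeDecay (K₀ kappa₀)
open Literature.MathematicalPhysics.QuantumFieldTheory.Balaban1983to89.TreeLengthTorus (TPt)
open Literature.MathematicalPhysics.QuantumFieldTheory.Balaban1983to89.B12Sec2to5 (betaPrime510)
open YMDAG.UVSplit (N22At ReadOutAt u3OfRecord₁₃ RateReading₁₃CoPH rateCarriersOfRecord₁₃CoPH)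
open YMDAG.N22.AtKernels (n22At_rateCarriers_of_kernels_pin_of_ne9)
open YMDAG.N22.AtRecordOfPrintedSlots (ne9_EA_objectsOfRecord₁₃_of_printedSlots kernelDecayOfRecord₁₃_of_printedSlots)
open YMDAG.N22.WindowedOfCouplingHolo (histPrefix_mem_box)
open YMDAG.N22.W1 (bound238_box_of_coordHolo youngLipschitz_box_of_coordHolo bound238_box_of_coordHoloLast youngLipschitz_box_of_coordHolo_vertex)
open Summit.QuantumFields.YangMills.BalabanUVNodes.N27ReadOutAtU3OfKernels (readOutAt_objectsOfRecord₁₃_coPH)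

open scoped Matrix.Norms.L2Operator

variable (F : T4Family) (N : ℕ) [NeZero N]

/-! ## §1 `h9` and `hdec` with W1's two (2.38)-slots READ FROM THE MARGIN DATUM (J31) on the boxes `W1.box θ.γ k` and PRINTED `AnalyticH` -/

open Classical in
/-- ★★★ **THE `h9` OF K3⁷ v5 §2b FROM THE MARGIN DATUM + PRINTED ANALYTICITY + (1.21) EXISTENCE.**  Per `(K, k)`: for every prefix `hist ∈ box θ.γ k`, polymer `Z`,
configuration `φ ∈ sp K k Z` and young coupling `i`, a holomorphic extension of `t ↦ H(Z; hist|hist_i := t; φ)` to a set containing the closed `ρt (k+1) i`-discs about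
`]0, θ.γ]`, bounded by `A·e^{−R d_{k+1}(Z)}` (J31's margin datum; `bound238_box_of_coordHolo` ∕ `youngLipschitz_box_of_coordHolo` give W1's two slots with the Cauchy table
`4A∕ρt (k+1) i`); PRINTED `AnalyticH` on the boxes; holomorphic readings with chart∕space clauses; site weights with tails; Road 1's numerals; `Localizes17OfRecord₁₃`;
`PolLimitsExistOfRecord₁₃`; a letter block `ℓ` with `ℓ.κ ≤ δ₁` and `C_9·(4A∕ρt k i) ≤ ℓ.moduli k i` ⟹ `NE9 ((objectsOfRecord₁₃ F N θ ℓ).EA 0) (Window θ.γ) ℓ.κ ℓ.moduli`.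
Vertex-awareness (J31): the margin is asked at `i = k` too — a displayed hypothesis, NOT print's [I] p. 263 clause.  LOCATED (hypothesis form); N22 NOT discharged. -/
theorem ne9_EA_objectsOfRecord₁₃_of_coordHolo_analyticH (θ : Stage13Params F N) (ℓ : U3Letters₁₁) (hs : ℓ.Signs) (hlim : PolLimitsExistOfRecord₁₃ F N θ)
    (m' : ℕ) (M : ℕ) [NeZero M] (hM : M = F.L ^ m')
    (S : (K : ℕ) → ClusterTower (F.P K) (MatA N) M) (emb : ReadingMaps F (MatA N) (MatA N)) (hloc : Localizes17OfRecord₁₃ F N θ S emb)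
    (sp : (K k : ℕ) → (domSys (F.P K) M (k + 1)).Dom → Set (CPair (F.P K) (MatA N)))
    {A R r₁ κ δ₀ B₃ r : ℝ} (ρt : ℕ → ℕ → ℝ) (hρt : ∀ n i, 0 < ρt n i)
    (hA : 0 < A) (hr₁ : 0 ≤ r₁) (hκ : κ ≤ r₁) (hκ₀ : kappa₀ (4 * 2 ^ 4) (2 * 4) ≤ κ / 2) (hrate : r₁ + 2 * (64 * Real.log 162) + 2 ≤ R)
    (hsmall : 2 * A * Real.exp (5 * r₁ + 1) * K₀ 64 8 * 9 * 64 ≤ 1) (hδ₀ : 0 < δ₀) (hB₃ : 0 ≤ B₃) (hr : 0 < r)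
    (hH : ∀ (K k : ℕ), ∀ hist ∈ box θ.γ k, ∀ (Z : (domSys (F.P K) M (k + 1)).Dom), ∀ φ ∈ sp K k Z, ∀ i : Fin (k + 1),
      ∃ (Hc : ℂ → ℂ) (O : Set ℂ), DifferentiableOn ℂ Hc O ∧ (∀ t ∈ Ioc (0 : ℝ) θ.γ, closedBall (t : ℂ) (ρt (k + 1) i) ⊆ O) ∧
        (∀ z ∈ O, ‖Hc z‖ ≤ A * Real.exp (-(R * (domSys (F.P K) M (k + 1)).dj Z))) ∧
        (∀ t ∈ Ioc (0 : ℝ) θ.γ, Hc t = ((S K) k).H (Function.update hist i t) φ Z))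
    (hAn : ∀ K k, ((S K) k).AnalyticH (box θ.γ k) (sp K k))
    (Ec : ℕ → ℕ → Type*) [∀ K k, NormedAddCommGroup (Ec K k)] [∀ K k, NormedSpace ℂ (Ec K k)]
    (ι : letI := θ.instVβ₁; letI := θ.instVβ₂
      (K k : ℕ) → (domSys (F.P K) M (k + 1)).Dom → ((Fin (F.P K).d → Site (F.P K) (k + 1) → θ.Vβ) →L[ℝ] Ec K k))
    (Φ : (K k : ℕ) → (domSys (F.P K) M (k + 1)).Dom → Ec K k → CPair (F.P K) (MatA N))
    (U : (K k : ℕ) → (domSys (F.P K) M (k + 1)).Dom → Set (Ec K k)) (hU : ∀ K k X, IsOpen (U K k X)) (hrU : ∀ K k X, ball (0 : Ec K k) r ⊆ U K k X)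
    (hΦhol : ∀ (K k : ℕ) (X : (domSys (F.P K) M (k + 1)).Dom), DifferentiableOn ℂ (Φ K k X) (U K k X))
    (hΦemb : letI := θ.instVβ₁; letI := θ.instVβ₂
      ∀ (K k : ℕ) (X : (domSys (F.P K) M (k + 1)).Dom) (B : Fin (F.P K).d → Site (F.P K) (k + 1) → θ.Vβ),
        Φ K k X (ι K k X B) = emb K k (fun l t => NormedSpace.exp (θ.ρ8 (B l t))))
    (hΦsp : ∀ (K k : ℕ) (X : (domSys (F.P K) M (k + 1)).Dom), ∀ z ∈ U K k X, ∀ Z : (domSys (F.P K) M (k + 1)).Dom, Z.1 ⊆ X.1 → Φ K k X z ∈ sp K k Z)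
    (w : (K k : ℕ) → (domSys (F.P K) M (k + 1)).Dom → Site (F.P K) (k + 1) → ℝ) (hw₀ : ∀ K k X t, 0 ≤ w K k X t)
    (hw : letI := θ.instVβ₁; letI := θ.instVβ₂; letI := θ.instιβ
      ∀ (K k : ℕ) (X : (domSys (F.P K) M (k + 1)).Dom) (l : Fin (F.P K).d) (t : Site (F.P K) (k + 1)) (c : θ.ιβ),
        ‖ι K k X (Pi.single l (Pi.single t (θ.bV c)))‖ ≤ w K k X t)
    (htail : ∀ (K k : ℕ) (X : (domSys (F.P K) M (k + 1)).Dom) (t : Site (F.P K) (k + 1)),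
      let e : Site (F.P K) (k + 1) → TPt 4 (domCount (F.P K) M (k + 1) * M) := fun x i => (ZMod.cast (x i) : ZMod (domCount (F.P K) M (k + 1) * M))
      w K k X t ≤ B₃ * Real.exp (-δ₀ * distCT (domCount (F.P K) M (k + 1)) M (e t) (nearT (M := M) (e t) X)))
    (hℓκ : ℓ.κ ≤ delta1 δ₀ κ ((M : ℝ) * 4))
    (hdom : ∀ k i, (16 * (8 * (Real.exp 1 * 9 * 64 * K₀ 64 8 ^ 2)) * B₃ ^ 2 / r ^ 2) *
        Real.exp (delta1 δ₀ κ ((M : ℝ) * 4) * ((M : ℝ) * 4) * 3) * K₀ (4 * 2 ^ 4) (2 * 4) * K₁ 4 (δ₀ / 2) * (4 * A / ρt k i) ≤ ℓ.moduli k i) :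
    NE9 ((objectsOfRecord₁₃ F N θ ℓ).EA 0) (Window θ.γ) ℓ.κ ℓ.moduli :=
  ne9_EA_objectsOfRecord₁₃_of_printedSlots F N θ ℓ hs hlim m' M hM S emb hloc (fun _ k => box θ.γ k) (fun _ hg _ k => histPrefix_mem_box hg k) sp
    (fun n i => 4 * A / ρt n i) hA hr₁ hκ hκ₀ hrate hsmall (fun n i => div_nonneg (mul_nonneg (by norm_num) hA.le) (hρt n i).le) hδ₀ hB₃ hr
    (fun K k => bound238_box_of_coordHolo ((S K) k) (sp K k) (fun i : Fin (k + 1) => ρt (k + 1) i) (fun _ => hρt _ _) (hH K k))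
    (fun K k => youngLipschitz_box_of_coordHolo ((S K) k) (sp K k) (fun i : Fin (k + 1) => ρt (k + 1) i) (fun _ => hρt _ _) (hH K k))
    hAn Ec ι Φ U hU hrU hΦhol hΦemb hΦsp w hw₀ hw htail hℓκ hdom

open Classical in
/-- ★★★ **THE `hdec` OF K3⁷ v5 §2b FROM THE MARGIN DATUM + PRINTED ANALYTICITY + (1.21) EXISTENCE**, at any rate `κ′ ≤ δ₁`: J31's margin datum (only `Bound238` is used —
`bound238_box_of_coordHolo`), PRINTED `AnalyticH` on the boxes, holomorphic readings, weights with tails, numerals (`0 < A`; single smallness), `Localizes17OfRecord₁₃`,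
`PolLimitsExistOfRecord₁₃` ⟹ `KernelDecayOfRecord₁₃ F N θ μ ν κ′`.  LOCATED (hypothesis form); (D4) NOT discharged. -/
theorem kernelDecayOfRecord₁₃_of_coordHolo_analyticH (θ : Stage13Params F N) (hlim : PolLimitsExistOfRecord₁₃ F N θ) (m' : ℕ) (M : ℕ) [NeZero M]
    (hM : M = F.L ^ m')
    (S : (K : ℕ) → ClusterTower (F.P K) (MatA N) M) (emb : ReadingMaps F (MatA N) (MatA N)) (hloc : Localizes17OfRecord₁₃ F N θ S emb)
    (sp : (K k : ℕ) → (domSys (F.P K) M (k + 1)).Dom → Set (CPair (F.P K) (MatA N)))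
    {A R r₁ κ δ₀ B₃ r κ' : ℝ} (ρt : ℕ → ℕ → ℝ) (hρt : ∀ n i, 0 < ρt n i)
    (hA : 0 ≤ A) (hr₁ : 0 ≤ r₁) (hκ : κ ≤ r₁) (hκ₀ : kappa₀ (4 * 2 ^ 4) (2 * 4) ≤ κ / 2) (hrate : r₁ + 2 * (64 * Real.log 162) + 2 ≤ R)
    (hsmall : A * Real.exp (5 * r₁ + 1) * K₀ 64 8 * 9 * 64 ≤ 1) (hδ₀ : 0 < δ₀) (hB₃ : 0 ≤ B₃) (hr : 0 < r)
    (hH : ∀ (K k : ℕ), ∀ hist ∈ box θ.γ k, ∀ (Z : (domSys (F.P K) M (k + 1)).Dom), ∀ φ ∈ sp K k Z, ∀ i : Fin (k + 1),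
      ∃ (Hc : ℂ → ℂ) (O : Set ℂ), DifferentiableOn ℂ Hc O ∧ (∀ t ∈ Ioc (0 : ℝ) θ.γ, closedBall (t : ℂ) (ρt (k + 1) i) ⊆ O) ∧
        (∀ z ∈ O, ‖Hc z‖ ≤ A * Real.exp (-(R * (domSys (F.P K) M (k + 1)).dj Z))) ∧
        (∀ t ∈ Ioc (0 : ℝ) θ.γ, Hc t = ((S K) k).H (Function.update hist i t) φ Z))
    (hAn : ∀ K k, ((S K) k).AnalyticH (box θ.γ k) (sp K k))
    (Ec : ℕ → ℕ → Type*) [∀ K k, NormedAddCommGroup (Ec K k)] [∀ K k, NormedSpace ℂ (Ec K k)]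
    (ι : letI := θ.instVβ₁; letI := θ.instVβ₂
      (K k : ℕ) → (domSys (F.P K) M (k + 1)).Dom → ((Fin (F.P K).d → Site (F.P K) (k + 1) → θ.Vβ) →L[ℝ] Ec K k))
    (Φ : (K k : ℕ) → (domSys (F.P K) M (k + 1)).Dom → Ec K k → CPair (F.P K) (MatA N))
    (U : (K k : ℕ) → (domSys (F.P K) M (k + 1)).Dom → Set (Ec K k)) (hU : ∀ K k X, IsOpen (U K k X)) (hrU : ∀ K k X, ball (0 : Ec K k) r ⊆ U K k X)
    (hΦhol : ∀ (K k : ℕ) (X : (domSys (F.P K) M (k + 1)).Dom), DifferentiableOn ℂ (Φ K k X) (U K k X))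
    (hΦemb : letI := θ.instVβ₁; letI := θ.instVβ₂
      ∀ (K k : ℕ) (X : (domSys (F.P K) M (k + 1)).Dom) (B : Fin (F.P K).d → Site (F.P K) (k + 1) → θ.Vβ),
        Φ K k X (ι K k X B) = emb K k (fun l t => NormedSpace.exp (θ.ρ8 (B l t))))
    (hΦsp : ∀ (K k : ℕ) (X : (domSys (F.P K) M (k + 1)).Dom), ∀ z ∈ U K k X, ∀ Z : (domSys (F.P K) M (k + 1)).Dom, Z.1 ⊆ X.1 → Φ K k X z ∈ sp K k Z)
    (w : (K k : ℕ) → (domSys (F.P K) M (k + 1)).Dom → Site (F.P K) (k + 1) → ℝ) (hw₀ : ∀ K k X t, 0 ≤ w K k X t)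
    (hw : letI := θ.instVβ₁; letI := θ.instVβ₂; letI := θ.instιβ
      ∀ (K k : ℕ) (X : (domSys (F.P K) M (k + 1)).Dom) (l : Fin (F.P K).d) (t : Site (F.P K) (k + 1)) (c : θ.ιβ),
        ‖ι K k X (Pi.single l (Pi.single t (θ.bV c)))‖ ≤ w K k X t)
    (htail : ∀ (K k : ℕ) (X : (domSys (F.P K) M (k + 1)).Dom) (t : Site (F.P K) (k + 1)),
      let e : Site (F.P K) (k + 1) → TPt 4 (domCount (F.P K) M (k + 1) * M) := fun x i => (ZMod.cast (x i) : ZMod (domCount (F.P K) M (k + 1) * M))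
      w K k X t ≤ B₃ * Real.exp (-δ₀ * distCT (domCount (F.P K) M (k + 1)) M (e t) (nearT (M := M) (e t) X)))
    (hκ' : κ' ≤ delta1 δ₀ κ ((M : ℝ) * 4)) (μ ν : Fin 4) :
    KernelDecayOfRecord₁₃ F N θ μ ν κ' :=
  kernelDecayOfRecord₁₃_of_printedSlots F N θ hlim m' M hM S emb hloc (fun _ k => box θ.γ k) (fun _ hg _ k => histPrefix_mem_box hg k) sp
    hA hr₁ hκ hκ₀ hrate hsmall hδ₀ hB₃ hr
    (fun K k => bound238_box_of_coordHolo ((S K) k) (sp K k) (fun i : Fin (k + 1) => ρt (k + 1) i) (fun _ => hρt _ _) (hH K k))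
    hAn Ec ι Φ U hU hrU hΦhol hΦemb hΦsp w hw₀ hw htail hκ' μ ν

/-! ## §1b VERTEX EDITION of `h9` — print's dilation shape in the LAST coupling (J31b ∕ J32′ §2b read at the record) -/

open Classical in
/-- ★★★ **THE `h9` OF K3⁷ v5 §2b, VERTEX EDITION** (J32′ §2b's road at the record): per `(K, k)` the OLDER coordinates `i < k` carry the uniform-margin datum (radii `ρt (k+1) i`,
bound `A·e^{−R d}`), the LAST coordinate the RELATIVE datum (discs `D̄(s, c·s)` about `s ∈ ]0, θ.γ]`, bound `A′·s·e^{−R d}` vanishing linearly at the vertex — J31b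
`bound238_box_of_coordHoloLast` ∕ `youngLipschitz_box_of_coordHolo_vertex`); PRINTED `AnalyticH` on the boxes; readings, weights∕tails, `Localizes17OfRecord₁₃`, `PolLimitsExistOfRecord₁₃`;
Road 1's numerals read at the `Bound238` amplitude `A′·θ.γ`; a letter block dominating the g-INDEPENDENT table `Λ n i = if i + 1 < n then 4A∕ρt n i else 8A′∕min(c,1)` ⟹
`NE9 ((objectsOfRecord₁₃ F N θ ℓ).EA 0) (Window θ.γ) ℓ.κ ℓ.moduli`.  LOCATED (hypothesis form); N22 NOT discharged. -/
theorem ne9_EA_objectsOfRecord₁₃_of_coordHoloVertex_analyticH (θ : Stage13Params F N) (ℓ : U3Letters₁₁) (hs : ℓ.Signs) (hlim : PolLimitsExistOfRecord₁₃ F N θ)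
    (m' : ℕ) (M : ℕ) [NeZero M] (hM : M = F.L ^ m')
    (S : (K : ℕ) → ClusterTower (F.P K) (MatA N) M) (emb : ReadingMaps F (MatA N) (MatA N)) (hloc : Localizes17OfRecord₁₃ F N θ S emb)
    (sp : (K k : ℕ) → (domSys (F.P K) M (k + 1)).Dom → Set (CPair (F.P K) (MatA N)))
    {A A' R r₁ κ δ₀ B₃ r c : ℝ} (ρt : ℕ → ℕ → ℝ) (hρt : ∀ n i, 0 < ρt n i) (hA : 0 ≤ A) (hA' : 0 ≤ A') (hc : 0 < c)
    (hAγ : 0 < A' * θ.γ) (hr₁ : 0 ≤ r₁) (hκ : κ ≤ r₁) (hκ₀ : kappa₀ (4 * 2 ^ 4) (2 * 4) ≤ κ / 2) (hrate : r₁ + 2 * (64 * Real.log 162) + 2 ≤ R)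
    (hsmall : 2 * (A' * θ.γ) * Real.exp (5 * r₁ + 1) * K₀ 64 8 * 9 * 64 ≤ 1) (hδ₀ : 0 < δ₀) (hB₃ : 0 ≤ B₃) (hr : 0 < r)
    (hOld : ∀ (K k : ℕ), ∀ hist ∈ box θ.γ k, ∀ (Z : (domSys (F.P K) M (k + 1)).Dom), ∀ φ ∈ sp K k Z, ∀ i : Fin (k + 1), (i : ℕ) < k →
      ∃ (Hc : ℂ → ℂ) (O : Set ℂ), DifferentiableOn ℂ Hc O ∧ (∀ t ∈ Ioc (0 : ℝ) θ.γ, closedBall (t : ℂ) (ρt (k + 1) i) ⊆ O) ∧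
        (∀ z ∈ O, ‖Hc z‖ ≤ A * Real.exp (-(R * (domSys (F.P K) M (k + 1)).dj Z))) ∧
        (∀ t ∈ Ioc (0 : ℝ) θ.γ, Hc t = ((S K) k).H (Function.update hist i t) φ Z))
    (hLast : ∀ (K k : ℕ), ∀ hist ∈ box θ.γ k, ∀ (Z : (domSys (F.P K) M (k + 1)).Dom), ∀ φ ∈ sp K k Z,
      ∃ (Hc : ℂ → ℂ) (O : Set ℂ), DifferentiableOn ℂ Hc O ∧ (∀ s ∈ Ioc (0 : ℝ) θ.γ, closedBall (s : ℂ) (c * s) ⊆ O) ∧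
        (∀ s ∈ Ioc (0 : ℝ) θ.γ, ∀ z ∈ closedBall (s : ℂ) (c * s), ‖Hc z‖ ≤ A' * s * Real.exp (-(R * (domSys (F.P K) M (k + 1)).dj Z))) ∧
        (∀ t ∈ Ioc (0 : ℝ) θ.γ, Hc t = ((S K) k).H (Function.update hist (Fin.last k) t) φ Z))
    (hAn : ∀ K k, ((S K) k).AnalyticH (box θ.γ k) (sp K k))
    (Ec : ℕ → ℕ → Type*) [∀ K k, NormedAddCommGroup (Ec K k)] [∀ K k, NormedSpace ℂ (Ec K k)]
    (ι : letI := θ.instVβ₁; letI := θ.instVβ₂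
      (K k : ℕ) → (domSys (F.P K) M (k + 1)).Dom → ((Fin (F.P K).d → Site (F.P K) (k + 1) → θ.Vβ) →L[ℝ] Ec K k))
    (Φ : (K k : ℕ) → (domSys (F.P K) M (k + 1)).Dom → Ec K k → CPair (F.P K) (MatA N))
    (U : (K k : ℕ) → (domSys (F.P K) M (k + 1)).Dom → Set (Ec K k)) (hU : ∀ K k X, IsOpen (U K k X)) (hrU : ∀ K k X, ball (0 : Ec K k) r ⊆ U K k X)
    (hΦhol : ∀ (K k : ℕ) (X : (domSys (F.P K) M (k + 1)).Dom), DifferentiableOn ℂ (Φ K k X) (U K k X))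
    (hΦemb : letI := θ.instVβ₁; letI := θ.instVβ₂
      ∀ (K k : ℕ) (X : (domSys (F.P K) M (k + 1)).Dom) (B : Fin (F.P K).d → Site (F.P K) (k + 1) → θ.Vβ),
        Φ K k X (ι K k X B) = emb K k (fun l t => NormedSpace.exp (θ.ρ8 (B l t))))
    (hΦsp : ∀ (K k : ℕ) (X : (domSys (F.P K) M (k + 1)).Dom), ∀ z ∈ U K k X, ∀ Z : (domSys (F.P K) M (k + 1)).Dom, Z.1 ⊆ X.1 → Φ K k X z ∈ sp K k Z)
    (w : (K k : ℕ) → (domSys (F.P K) M (k + 1)).Dom → Site (F.P K) (k + 1) → ℝ) (hw₀ : ∀ K k X t, 0 ≤ w K k X t)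
    (hw : letI := θ.instVβ₁; letI := θ.instVβ₂; letI := θ.instιβ
      ∀ (K k : ℕ) (X : (domSys (F.P K) M (k + 1)).Dom) (l : Fin (F.P K).d) (t : Site (F.P K) (k + 1)) (c : θ.ιβ),
        ‖ι K k X (Pi.single l (Pi.single t (θ.bV c)))‖ ≤ w K k X t)
    (htail : ∀ (K k : ℕ) (X : (domSys (F.P K) M (k + 1)).Dom) (t : Site (F.P K) (k + 1)),
      let e : Site (F.P K) (k + 1) → TPt 4 (domCount (F.P K) M (k + 1) * M) := fun x i => (ZMod.cast (x i) : ZMod (domCount (F.P K) M (k + 1) * M))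
      w K k X t ≤ B₃ * Real.exp (-δ₀ * distCT (domCount (F.P K) M (k + 1)) M (e t) (nearT (M := M) (e t) X)))
    (hℓκ : ℓ.κ ≤ delta1 δ₀ κ ((M : ℝ) * 4))
    (hdom : ∀ k i, (16 * (8 * (Real.exp 1 * 9 * 64 * K₀ 64 8 ^ 2)) * B₃ ^ 2 / r ^ 2) *
        Real.exp (delta1 δ₀ κ ((M : ℝ) * 4) * ((M : ℝ) * 4) * 3) * K₀ (4 * 2 ^ 4) (2 * 4) * K₁ 4 (δ₀ / 2) *
          (if i + 1 < k then 4 * A / ρt k i else 8 * A' / min c 1) ≤ ℓ.moduli k i) :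
    NE9 ((objectsOfRecord₁₃ F N θ ℓ).EA 0) (Window θ.γ) ℓ.κ ℓ.moduli := by
  have hΛ0 : ∀ n i : ℕ, 0 ≤ (if i + 1 < n then 4 * A / ρt n i else 8 * A' / min c 1) := by
    intro n i
    split_ifs
    · exact div_nonneg (mul_nonneg (by norm_num) hA) (hρt n i).le
    · exact div_nonneg (mul_nonneg (by norm_num) hA') (le_min hc.le zero_le_one)
  have hYL : ∀ K k, ((S K) k).YoungLipschitz (box θ.γ k) (sp K k)
      (fun i : Fin (k + 1) => if (i : ℕ) + 1 < k + 1 then 4 * A / ρt (k + 1) i else 8 * A' / min c 1) R := by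
    intro K k
    have e : (fun i : Fin (k + 1) => if (i : ℕ) + 1 < k + 1 then 4 * A / ρt (k + 1) i else 8 * A' / min c 1) =
        (fun i : Fin (k + 1) => if (i : ℕ) < k then 4 * A / (fun j : Fin (k + 1) => ρt (k + 1) j) i else 8 * A' / min c 1) := by
      funext i
      simp only [Nat.add_lt_add_iff_right]
    rw [e]
    exact youngLipschitz_box_of_coordHolo_vertex ((S K) k) (sp K k) (fun j : Fin (k + 1) => ρt (k + 1) j) (fun _ => hρt _ _) hc
      (hOld K k) (hLast K k)
  exact ne9_EA_objectsOfRecord₁₃_of_printedSlots F N θ ℓ hs hlim m' M hM S emb hloc (fun _ k => box θ.γ k) (fun _ hg _ k => histPrefix_mem_box hg k) sp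
    (fun n i => if i + 1 < n then 4 * A / ρt n i else 8 * A' / min c 1) hAγ hr₁ hκ hκ₀ hrate hsmall hΛ0 hδ₀ hB₃ hr
    (fun K k => bound238_box_of_coordHoloLast ((S K) k) (sp K k) hA' hc (hLast K k)) hYL
    hAn Ec ι Φ U hU hrU hΦhol hΦemb hΦsp w hw₀ hw htail hℓκ hdom

/-! ## §2 The PIN FACES for every run length at a reading pinned to the kernel objects of record -/

open Classical in
/-- ★★★ **THE N22 PIN FACE FROM THE MARGIN DATUM + PRINTED ANALYTICITY + (1.21) EXISTENCE** — K3⁷ v5's N22 conjunct `N22At (rateCarriersOfRecord₁₃CoPH 𝔯 F θ hP g₀ os k).u3`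
for EVERY `k` at a reading pinned to the kernel objects of record, for a letter block dominating the engine's constants over J31's Cauchy table `4A∕ρt k i`
(`ne9_EA_objectsOfRecord₁₃_of_coordHolo_analyticH` fed to dag-n22-w3's `n22At_rateCarriers_of_kernels_pin_of_ne9`).  LOCATED (hypothesis form); N22 NOT discharged. -/
theorem n22At_rateCarriers_of_kernels_pin_of_coordHolo_analyticH (𝔯 : RateReading₁₃CoPH N) (θ : Stage13HParams F N) (hP : θ.Provisos₁₃CoPH F N)
    (g₀ : ℕ → ℝ) (os : List (ULoop F)) (ℓ : U3Letters₁₁) (hs : ℓ.Signs) (hpin : (𝔯.lit F θ hP g₀ os).u3 = objectsOfRecord₁₃ F N θ.toStage13Params ℓ)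
    (hlim : PolLimitsExistOfRecord₁₃ F N θ.toStage13Params) (m' : ℕ) (M : ℕ) [NeZero M] (hM : M = F.L ^ m')
    (S : (K : ℕ) → ClusterTower (F.P K) (MatA N) M) (emb : ReadingMaps F (MatA N) (MatA N)) (hloc : Localizes17OfRecord₁₃ F N θ.toStage13Params S emb)
    (sp : (K k : ℕ) → (domSys (F.P K) M (k + 1)).Dom → Set (CPair (F.P K) (MatA N)))
    {A R r₁ κ δ₀ B₃ r : ℝ} (ρt : ℕ → ℕ → ℝ) (hρt : ∀ n i, 0 < ρt n i)
    (hA : 0 < A) (hr₁ : 0 ≤ r₁) (hκ : κ ≤ r₁) (hκ₀ : kappa₀ (4 * 2 ^ 4) (2 * 4) ≤ κ / 2) (hrate : r₁ + 2 * (64 * Real.log 162) + 2 ≤ R)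
    (hsmall : 2 * A * Real.exp (5 * r₁ + 1) * K₀ 64 8 * 9 * 64 ≤ 1) (hδ₀ : 0 < δ₀) (hB₃ : 0 ≤ B₃) (hr : 0 < r)
    (hH : ∀ (K k : ℕ), ∀ hist ∈ box θ.γ k, ∀ (Z : (domSys (F.P K) M (k + 1)).Dom), ∀ φ ∈ sp K k Z, ∀ i : Fin (k + 1),
      ∃ (Hc : ℂ → ℂ) (O : Set ℂ), DifferentiableOn ℂ Hc O ∧ (∀ t ∈ Ioc (0 : ℝ) θ.γ, closedBall (t : ℂ) (ρt (k + 1) i) ⊆ O) ∧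
        (∀ z ∈ O, ‖Hc z‖ ≤ A * Real.exp (-(R * (domSys (F.P K) M (k + 1)).dj Z))) ∧
        (∀ t ∈ Ioc (0 : ℝ) θ.γ, Hc t = ((S K) k).H (Function.update hist i t) φ Z))
    (hAn : ∀ K k, ((S K) k).AnalyticH (box θ.γ k) (sp K k))
    (Ec : ℕ → ℕ → Type*) [∀ K k, NormedAddCommGroup (Ec K k)] [∀ K k, NormedSpace ℂ (Ec K k)]
    (ι : letI := θ.instVβ₁; letI := θ.instVβ₂
      (K k : ℕ) → (domSys (F.P K) M (k + 1)).Dom → ((Fin (F.P K).d → Site (F.P K) (k + 1) → θ.Vβ) →L[ℝ] Ec K k))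
    (Φ : (K k : ℕ) → (domSys (F.P K) M (k + 1)).Dom → Ec K k → CPair (F.P K) (MatA N))
    (U : (K k : ℕ) → (domSys (F.P K) M (k + 1)).Dom → Set (Ec K k)) (hU : ∀ K k X, IsOpen (U K k X)) (hrU : ∀ K k X, ball (0 : Ec K k) r ⊆ U K k X)
    (hΦhol : ∀ (K k : ℕ) (X : (domSys (F.P K) M (k + 1)).Dom), DifferentiableOn ℂ (Φ K k X) (U K k X))
    (hΦemb : letI := θ.instVβ₁; letI := θ.instVβ₂
      ∀ (K k : ℕ) (X : (domSys (F.P K) M (k + 1)).Dom) (B : Fin (F.P K).d → Site (F.P K) (k + 1) → θ.Vβ),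
        Φ K k X (ι K k X B) = emb K k (fun l t => NormedSpace.exp (θ.ρ8 (B l t))))
    (hΦsp : ∀ (K k : ℕ) (X : (domSys (F.P K) M (k + 1)).Dom), ∀ z ∈ U K k X, ∀ Z : (domSys (F.P K) M (k + 1)).Dom, Z.1 ⊆ X.1 → Φ K k X z ∈ sp K k Z)
    (w : (K k : ℕ) → (domSys (F.P K) M (k + 1)).Dom → Site (F.P K) (k + 1) → ℝ) (hw₀ : ∀ K k X t, 0 ≤ w K k X t)
    (hw : letI := θ.instVβ₁; letI := θ.instVβ₂; letI := θ.instιβ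
      ∀ (K k : ℕ) (X : (domSys (F.P K) M (k + 1)).Dom) (l : Fin (F.P K).d) (t : Site (F.P K) (k + 1)) (c : θ.ιβ),
        ‖ι K k X (Pi.single l (Pi.single t (θ.bV c)))‖ ≤ w K k X t)
    (htail : ∀ (K k : ℕ) (X : (domSys (F.P K) M (k + 1)).Dom) (t : Site (F.P K) (k + 1)),
      let e : Site (F.P K) (k + 1) → TPt 4 (domCount (F.P K) M (k + 1) * M) := fun x i => (ZMod.cast (x i) : ZMod (domCount (F.P K) M (k + 1) * M))
      w K k X t ≤ B₃ * Real.exp (-δ₀ * distCT (domCount (F.P K) M (k + 1)) M (e t) (nearT (M := M) (e t) X)))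
    (hℓκ : ℓ.κ ≤ delta1 δ₀ κ ((M : ℝ) * 4))
    (hdom : ∀ k i, (16 * (8 * (Real.exp 1 * 9 * 64 * K₀ 64 8 ^ 2)) * B₃ ^ 2 / r ^ 2) *
        Real.exp (delta1 δ₀ κ ((M : ℝ) * 4) * ((M : ℝ) * 4) * 3) * K₀ (4 * 2 ^ 4) (2 * 4) * K₁ 4 (δ₀ / 2) * (4 * A / ρt k i) ≤ ℓ.moduli k i) (k : ℕ) :
    N22At (rateCarriersOfRecord₁₃CoPH 𝔯 F θ hP g₀ os k).u3 :=
  n22At_rateCarriers_of_kernels_pin_of_ne9 𝔯 θ hP g₀ os ℓ hs hpin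
    (ne9_EA_objectsOfRecord₁₃_of_coordHolo_analyticH F N θ.toStage13Params ℓ hs hlim m' M hM S emb hloc sp ρt hρt hA hr₁ hκ hκ₀ hrate hsmall hδ₀ hB₃ hr
      hH hAn Ec ι Φ U hU hrU hΦhol hΦemb hΦsp w hw₀ hw htail hℓκ hdom) k


open Classical in
/-- ★★★ **THE (D4) PIN FACE FROM THE MARGIN DATUM + PRINTED ANALYTICITY + (1.21) EXISTENCE + THE LETTER ROWS** — `ReadOutAt (datumOfRecord₁₃CoPH F N θ hP)
(rateCarriersOfRecord₁₃CoPH 𝔯 F θ hP g₀ os k).u3` for EVERY `k` at a reading pinned to the kernel objects of record, for a letter block with `ℓ.Signs`, `0 < ℓ.κ ≤ δ₁`,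
`β′₅.₁₀(4,1,ℓ.κ) ≤ ℓ.cr` (§1's `kernelDecayOfRecord₁₃_of_coordHolo_analyticH` at `(0, 1)`, `κ′ := ℓ.κ`, fed to dag-n27-w1's `readOutAt_objectsOfRecord₁₃_coPH`; (5.10) NOT discharged).
LOCATED (hypothesis form); (D4) NOT discharged. -/
theorem readOutAt_rateCarriers_of_kernels_pin_of_coordHolo_analyticH (𝔯 : RateReading₁₃CoPH N) (θ : Stage13HParams F N) (hP : θ.Provisos₁₃CoPH F N)
    (g₀ : ℕ → ℝ) (os : List (ULoop F)) (ℓ : U3Letters₁₁) (hs : ℓ.Signs) (hℓ₀ : 0 < ℓ.κ) (hcr : betaPrime510 4 1 ℓ.κ ≤ ℓ.cr)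
    (hpin : (𝔯.lit F θ hP g₀ os).u3 = objectsOfRecord₁₃ F N θ.toStage13Params ℓ)
    (hlim : PolLimitsExistOfRecord₁₃ F N θ.toStage13Params) (m' : ℕ) (M : ℕ) [NeZero M] (hM : M = F.L ^ m')
    (S : (K : ℕ) → ClusterTower (F.P K) (MatA N) M) (emb : ReadingMaps F (MatA N) (MatA N)) (hloc : Localizes17OfRecord₁₃ F N θ.toStage13Params S emb)
    (sp : (K k : ℕ) → (domSys (F.P K) M (k + 1)).Dom → Set (CPair (F.P K) (MatA N)))
    {A R r₁ κ δ₀ B₃ r : ℝ} (ρt : ℕ → ℕ → ℝ) (hρt : ∀ n i, 0 < ρt n i)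
    (hA : 0 ≤ A) (hr₁ : 0 ≤ r₁) (hκ : κ ≤ r₁) (hκ₀ : kappa₀ (4 * 2 ^ 4) (2 * 4) ≤ κ / 2) (hrate : r₁ + 2 * (64 * Real.log 162) + 2 ≤ R)
    (hsmall : A * Real.exp (5 * r₁ + 1) * K₀ 64 8 * 9 * 64 ≤ 1) (hδ₀ : 0 < δ₀) (hB₃ : 0 ≤ B₃) (hr : 0 < r)
    (hH : ∀ (K k : ℕ), ∀ hist ∈ box θ.γ k, ∀ (Z : (domSys (F.P K) M (k + 1)).Dom), ∀ φ ∈ sp K k Z, ∀ i : Fin (k + 1),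
      ∃ (Hc : ℂ → ℂ) (O : Set ℂ), DifferentiableOn ℂ Hc O ∧ (∀ t ∈ Ioc (0 : ℝ) θ.γ, closedBall (t : ℂ) (ρt (k + 1) i) ⊆ O) ∧
        (∀ z ∈ O, ‖Hc z‖ ≤ A * Real.exp (-(R * (domSys (F.P K) M (k + 1)).dj Z))) ∧
        (∀ t ∈ Ioc (0 : ℝ) θ.γ, Hc t = ((S K) k).H (Function.update hist i t) φ Z))
    (hAn : ∀ K k, ((S K) k).AnalyticH (box θ.γ k) (sp K k))
    (Ec : ℕ → ℕ → Type*) [∀ K k, NormedAddCommGroup (Ec K k)] [∀ K k, NormedSpace ℂ (Ec K k)]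
    (ι : letI := θ.instVβ₁; letI := θ.instVβ₂
      (K k : ℕ) → (domSys (F.P K) M (k + 1)).Dom → ((Fin (F.P K).d → Site (F.P K) (k + 1) → θ.Vβ) →L[ℝ] Ec K k))
    (Φ : (K k : ℕ) → (domSys (F.P K) M (k + 1)).Dom → Ec K k → CPair (F.P K) (MatA N))
    (U : (K k : ℕ) → (domSys (F.P K) M (k + 1)).Dom → Set (Ec K k)) (hU : ∀ K k X, IsOpen (U K k X)) (hrU : ∀ K k X, ball (0 : Ec K k) r ⊆ U K k X)
    (hΦhol : ∀ (K k : ℕ) (X : (domSys (F.P K) M (k + 1)).Dom), DifferentiableOn ℂ (Φ K k X) (U K k X))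
    (hΦemb : letI := θ.instVβ₁; letI := θ.instVβ₂
      ∀ (K k : ℕ) (X : (domSys (F.P K) M (k + 1)).Dom) (B : Fin (F.P K).d → Site (F.P K) (k + 1) → θ.Vβ),
        Φ K k X (ι K k X B) = emb K k (fun l t => NormedSpace.exp (θ.ρ8 (B l t))))
    (hΦsp : ∀ (K k : ℕ) (X : (domSys (F.P K) M (k + 1)).Dom), ∀ z ∈ U K k X, ∀ Z : (domSys (F.P K) M (k + 1)).Dom, Z.1 ⊆ X.1 → Φ K k X z ∈ sp K k Z)
    (w : (K k : ℕ) → (domSys (F.P K) M (k + 1)).Dom → Site (F.P K) (k + 1) → ℝ) (hw₀ : ∀ K k X t, 0 ≤ w K k X t)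
    (hw : letI := θ.instVβ₁; letI := θ.instVβ₂; letI := θ.instιβ
      ∀ (K k : ℕ) (X : (domSys (F.P K) M (k + 1)).Dom) (l : Fin (F.P K).d) (t : Site (F.P K) (k + 1)) (c : θ.ιβ),
        ‖ι K k X (Pi.single l (Pi.single t (θ.bV c)))‖ ≤ w K k X t)
    (htail : ∀ (K k : ℕ) (X : (domSys (F.P K) M (k + 1)).Dom) (t : Site (F.P K) (k + 1)),
      let e : Site (F.P K) (k + 1) → TPt 4 (domCount (F.P K) M (k + 1) * M) := fun x i => (ZMod.cast (x i) : ZMod (domCount (F.P K) M (k + 1) * M))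
      w K k X t ≤ B₃ * Real.exp (-δ₀ * distCT (domCount (F.P K) M (k + 1)) M (e t) (nearT (M := M) (e t) X)))
    (hℓκ : ℓ.κ ≤ delta1 δ₀ κ ((M : ℝ) * 4)) (k : ℕ) :
    ReadOutAt (datumOfRecord₁₃CoPH F N θ hP) (rateCarriersOfRecord₁₃CoPH 𝔯 F θ hP g₀ os k).u3 := by
  show ReadOutAt (datumOfRecord₁₃CoPH F N θ hP) (u3OfRecord₁₃ θ.toStage13Params (𝔯.lit F θ hP g₀ os).u3 k)
  rw [hpin]
  exact readOutAt_objectsOfRecord₁₃_coPH θ hP ℓ hs hℓ₀ hcr k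
    (kernelDecayOfRecord₁₃_of_coordHolo_analyticH F N θ.toStage13Params hlim m' M hM S emb hloc sp ρt hρt hA hr₁ hκ hκ₀ hrate hsmall hδ₀ hB₃ hr hH hAn
      Ec ι Φ U hU hrU hΦhol hΦemb hΦsp w hw₀ hw htail hℓκ 0 1)

end YMDAG.N22.AtRecordOfCouplingHoloSlots

end
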